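import Summits.QuantumFields.QCD.Theses.WilsonMobilityGap
import Literature.MathematicalPhysics.QuantumLattice.WilsonPositivityDomain
import Literature.MathematicalPhysics.QuantumFieldTheory.QCDPhaseQuenchedPositivity

/-!
# Crux `ChiralMobilityGap` (stmt-QuantumFields-17497) — ideator 3, round 1: first lemmas

Idea card `sign-threshold-anchor` (`Cruxes/ChiralMobilityGap/Ideas/sign-threshold-anchor.md`).

§1  The crux re-read clause by clause (definitional, `Iff.rfl`), with the NEW conjunct `IsChiralAtZero`.
§2  THE LEVER.  The sign-coherence certificate of clause (iv) defines an UP-CLOSED set of "good floors"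
    that is CLOSED UNDER DECREASING LIMITS WITHOUT ANY CONTINUITY (the certificate at floor `u` only
    speaks of tuples strictly above `u`) and contains `0` (Seiler positivity: all-positive tuples have
    ratio `1`).  Hence `signThr := sInf` is attained, lies in `[-1, 0]`, and EVERY tuple strictly above it
    is sign-coherent.  Raising any candidate `m_crit` to `max m_crit signThr` makes clauses (i) and (iv)
    hold BY CONSTRUCTION, for every positive mass tuple, every `k`, every volume sequence.
§3  The transfer `ChiralMobilityGap_of_signReg`: the crux follows from mass/asymptotic scaling,
    (ii), (iii) and the chiral pin (v) for the SIGN-ANCHORED regularisation — clauses (i), (iv) are gone.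
§4  The pin (v) is a VANISHING LOWER RATE: the analytic core (`frequently_exceeds_of_lower`): a lower
    bound `c₀ e^{-(C₁ a_k n + p log(n+1))}` up to the scheme's own volume beats `K e^{-ε a_k n}` for
    every `K` as soon as `C₁ < ε` (choose `n = L_k`, `a_k L_k → ∞`).
-/

noncomputable section

namespace Summit.QuantumFields.QCD.Cruxes.ChiralMobilityGap.SignThreshold

open scoped BigOperators Topology
open MeasureTheory Filter Set
open Literature.MathematicalPhysics.QuantumFieldTheory Literature.MathematicalPhysics.QuantumLattice
  Literature.Probability.LatticeModels

local notation "𝔾₃" => Matrix.specialUnitaryGroup (Fin 3) ℂ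

variable {Nf : ℕ}

/-! ### §1 The crux, clause by clause -/

/-- The realised bare-mass tuple at step `k`. -/
abbrev bare (reg : QCDRegularisation Nf) (m : Fin Nf → ℝ) (k : ℕ) : Fin Nf → ℝ :=
  fun fl => reg.mcrit k + reg.a k * m fl / reg.Zm k

/-- The phase-quenched fractional moment of clauses (ii)/(iii) (verbatim). -/
def fm (Nf : ℕ) (β : ℝ) (mq : Fin Nf → ℝ) (S : ℕ) (f : Fin Nf) (v : Site 4) (s : ℝ) : ℝ :=
  (∫ U : GaugeConfig 4 (2 * S + 1) 𝔾₃,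
      ‖(diracMatrix U mq).det‖ *
        (∑ a : Fin 3, ∑ i : Fin 4, ∑ b : Fin 3, ∑ j : Fin 4,
          ‖(diracMatrix U mq)⁻¹ (quarkEquiv (f, (Torus.proj (2 * S + 1) 0, a, i)))
            (quarkEquiv (f, (Torus.proj (2 * S + 1) v, b, j)))‖) ^ s
      ∂(wilsonMeasure (fundamentalRep (Fin 3)) β)) /
    (∫ U : GaugeConfig 4 (2 * S + 1) 𝔾₃,
      ‖(diracMatrix U mq).det‖ ∂(wilsonMeasure (fundamentalRep (Fin 3)) β))

/-- Clause (i). -/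
def ClauseI (reg : QCDRegularisation Nf) (m : Fin Nf → ℝ) : Prop :=
  ∀ f : Fin Nf, ∀ᶠ k in atTop, -1 < reg.mcrit k + reg.a k * m f / reg.Zm k

/-- Clause (ii) UPPER. -/
def Upper (reg : QCDRegularisation Nf) (m : Fin Nf → ℝ) : Prop :=
  ∃ s δ C : ℝ, 0 < s ∧ s < 1 ∧ 0 < δ ∧ ∀ᶠ k in atTop, ∀ S : ℕ, reg.L k ≤ S →
    ∀ (f : Fin Nf) (v : Site 4), v ∈ box 4 S →
      fm Nf (reg.β k) (bare reg m k) S f v s ≤ C * Real.exp (-(δ * (reg.a k * ‖v‖)))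

/-- Clause (iii) LOWER. -/
def Lower (reg : QCDRegularisation Nf) (m : Fin Nf → ℝ) : Prop :=
  ∃ s c₀ C₁ p : ℝ, 0 < s ∧ s < 1 ∧ 0 < c₀ ∧ ∀ᶠ k in atTop, ∀ S : ℕ, reg.L k ≤ S →
    ∀ (f : Fin Nf) (n : ℕ), n ≤ S →
      c₀ * Real.exp (-(C₁ * (reg.a k * n) + p * Real.log (n + 1))) ≤
        fm Nf (reg.β k) (bare reg m k) S f (Pi.single 0 (n : ℤ)) s

/-- The sign-coherence ratio `|∫ det| / ∫ |det|` at coupling `β`, torus side `2L+1`, bare tuple `t`. -/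
def signRatio (Nf : ℕ) (β : ℝ) (L : ℕ) (t : Fin Nf → ℝ) : ℝ :=
  ‖∫ U : GaugeConfig 4 (2 * L + 1) 𝔾₃, (diracMatrix U t).det ∂(wilsonMeasure (fundamentalRep (Fin 3)) β)‖ /
    (∫ U : GaugeConfig 4 (2 * L + 1) 𝔾₃, ‖(diracMatrix U t).det‖ ∂(wilsonMeasure (fundamentalRep (Fin 3)) β))

/-- Clause (iv) SIGN: coherence at the scheme's own side `2L_k+1`. -/
def Sign (reg : QCDRegularisation Nf) (m : Fin Nf → ℝ) : Prop :=
  ∀ᶠ k in atTop, (1 / 2 : ℝ) ≤ signRatio Nf (reg.β k) (reg.L k) (bare reg m k)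

/-- **The crux re-read** (definitional): scalings, the chiral pin (v), and (i)–(iv) for all `m > 0`. -/
theorem chiralMobilityGap_iff :
    Summit.QuantumFields.QCD.Theses.WilsonMobilityGap.ChiralMobilityGap ↔
      ∀ Nf : ℕ, Nf = 2 ∨ Nf = 3 → ∃ reg : QCDRegularisation Nf,
        reg.HasMassScaling ∧ reg.IsChiralAtZero ∧ (reg.scheme 0 0 0).HasAsymptoticScaling ∧
          ∀ m : Fin Nf → ℝ, (∀ f, 0 < m f) → ClauseI reg m ∧ Upper reg m ∧ Lower reg m ∧ Sign reg m :=
  Iff.rfl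

/-! ### §2 THE LEVER: the sign-coherence threshold -/

/-- `IsSignGoodFloor β L u`: EVERY bare tuple strictly above the floor `u` is sign-coherent
(`|∫ det| ≥ ½ ∫ |det|`) on the torus of side `2L+1` at coupling `β`. -/
def IsSignGoodFloor (Nf : ℕ) (β : ℝ) (L : ℕ) (u : ℝ) : Prop :=
  ∀ t : Fin Nf → ℝ, (∀ f, u < t f) → (1 / 2 : ℝ) ≤ signRatio Nf β L t

/-- Good sign floors on the physical branch `u ≥ -1`. -/
def signFloorSet (Nf : ℕ) (β : ℝ) (L : ℕ) : Set ℝ := {u | -1 ≤ u ∧ IsSignGoodFloor Nf β L u}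

/-- **THE SIGN THRESHOLD** `signThr := inf {u ≥ -1 | every tuple above u is sign-coherent}` — the
parity onset of the Wilson determinant sign on the scheme's own torus, read downwards in the bare mass. -/
def signThr (Nf : ℕ) (β : ℝ) (L : ℕ) : ℝ := sInf (signFloorSet Nf β L)

/-- Good sign floors form an up-set. -/
theorem isSignGoodFloor_mono {β : ℝ} {L : ℕ} {u u' : ℝ} (h : u ≤ u')
    (hu : IsSignGoodFloor Nf β L u) : IsSignGoodFloor Nf β L u' :=
  fun t ht => hu t fun f => h.trans_lt (ht f)

/-- For an all-POSITIVE bare tuple the multi-flavour Wilson determinant is the positive real `|det|`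
(Seiler positivity, flavour by flavour; copied from `Cruxes/MobilityGap/Disproof.lean` §3). -/
theorem det_diracMatrix_eq_norm_of_pos {S : ℕ} [NeZero S] (U : GaugeConfig 4 S 𝔾₃)
    (mq : Fin Nf → ℝ) (hmq : ∀ f, 0 < mq f) :
    (diracMatrix U mq).det = ((‖(diracMatrix U mq).det‖ : ℝ) : ℂ) := by
  have hre : 0 < ((diracMatrix U mq).det).re := by
    have hf : ∀ f, fermionDet (wilsonDirac (fundamentalRep (Fin 3)) U (mq f) 1) =
        (((fermionDet (wilsonDirac (fundamentalRep (Fin 3)) U (mq f) 1)).re : ℝ) : ℂ) := fun f =>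
      fermionDet_wilsonDirac_eq_ofReal_of_mass_pos _ fundamentalRep_mem_unitaryGroup U (mq f)
    rw [det_diracMatrix, Finset.prod_congr rfl fun f _ => hf f, ← Complex.ofReal_prod,
      Complex.ofReal_re]
    exact Finset.prod_pos fun f _ =>
      fermionDet_wilsonDirac_re_pos _ fundamentalRep_mem_unitaryGroup U (hmq f)
  rw [norm_det_diracMatrix_eq_abs_re, abs_of_pos hre]
  exact det_diracMatrix_eq_ofReal_re U mq

/-- The sign-coherence ratio is exactly `1` for all-positive tuples (every `β`, every side). -/
theorem signRatio_eq_one_of_pos (β : ℝ) (L : ℕ) (t : Fin Nf → ℝ) (ht : ∀ f, 0 < t f) :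
    signRatio Nf β L t = 1 := by
  unfold signRatio
  have hZ := integral_norm_det_diracMatrix_pos_all (S := 2 * L + 1) β t
  have hI : ∫ U : GaugeConfig 4 (2 * L + 1) 𝔾₃, (diracMatrix U t).det
        ∂(wilsonMeasure (fundamentalRep (Fin 3)) β) =
      ∫ U : GaugeConfig 4 (2 * L + 1) 𝔾₃, ((‖(diracMatrix U t).det‖ : ℝ) : ℂ)
        ∂(wilsonMeasure (fundamentalRep (Fin 3)) β) :=
    integral_congr_ae (Eventually.of_forall fun U => det_diracMatrix_eq_norm_of_pos U t ht)
  rw [hI, integral_complex_ofReal, Complex.norm_real, Real.norm_eq_abs, abs_of_pos hZ, div_self hZ.ne']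

/-- `0` is a good sign floor (tuples above `0` are positive). -/
theorem isSignGoodFloor_zero (β : ℝ) (L : ℕ) : IsSignGoodFloor Nf β L 0 := fun t ht => by
  rw [signRatio_eq_one_of_pos β L t ht]; norm_num

/-- `0 ∈ signFloorSet`. -/
theorem zero_mem_signFloorSet (β : ℝ) (L : ℕ) : (0 : ℝ) ∈ signFloorSet Nf β L :=
  ⟨by norm_num, isSignGoodFloor_zero β L⟩

/-- The sign floor set is bounded below by `-1`. -/
theorem signFloorSet_bddBelow (β : ℝ) (L : ℕ) : BddBelow (signFloorSet Nf β L) :=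
  ⟨-1, fun _ hu => hu.1⟩

/-- `-1 ≤ signThr`. -/
theorem neg_one_le_signThr (β : ℝ) (L : ℕ) : -1 ≤ signThr Nf β L :=
  le_csInf ⟨0, zero_mem_signFloorSet β L⟩ fun _ hu => hu.1

/-- `signThr ≤ 0`. -/
theorem signThr_le_zero (β : ℝ) (L : ℕ) : signThr Nf β L ≤ 0 :=
  csInf_le (signFloorSet_bddBelow β L) (zero_mem_signFloorSet β L)

/-- **ATTAINMENT WITHOUT CONTINUITY.** The sign threshold is itself a good floor: a tuple all of whose
components lie STRICTLY above `signThr` lies strictly above some good floor. -/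
theorem isSignGoodFloor_signThr (β : ℝ) (L : ℕ) : IsSignGoodFloor Nf β L (signThr Nf β L) := by
  classical
  intro t ht
  rcases isEmpty_or_nonempty (Fin Nf) with hE | hN
  · rw [signRatio_eq_one_of_pos β L t fun f => (IsEmpty.false f).elim]; norm_num
  · obtain ⟨f₀, hf₀⟩ := Finite.exists_min t
    obtain ⟨u, hu, hut⟩ := exists_lt_of_csInf_lt ⟨0, zero_mem_signFloorSet β L⟩ (ht f₀)
    exact hu.2 t fun f => hut.trans_le (hf₀ f)

/-- **Clause (iv) by construction**: every tuple strictly above the sign threshold is coherent. -/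
theorem half_le_signRatio_of_signThr_lt (β : ℝ) (L : ℕ) (t : Fin Nf → ℝ)
    (ht : ∀ f, signThr Nf β L < t f) : (1 / 2 : ℝ) ≤ signRatio Nf β L t :=
  isSignGoodFloor_signThr β L t ht

/-- **Minimality** (the free LOWER bound on sign activity just below the anchor): every floor strictly
below `signThr` (and `≥ -1`) has a tuple above it with sign ratio `< 1/2`. -/
theorem exists_incoherent_of_lt_signThr (β : ℝ) (L : ℕ) {x : ℝ} (hx1 : -1 ≤ x)
    (hx : x < signThr Nf β L) : ∃ t : Fin Nf → ℝ, (∀ f, x < t f) ∧ signRatio Nf β L t < 1 / 2 := by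
  by_contra h
  push_neg at h
  have hmem : x ∈ signFloorSet Nf β L := ⟨hx1, fun t ht => h t ht⟩
  exact absurd (csInf_le (signFloorSet_bddBelow β L) hmem) (not_le.2 hx)

/-! ### §3 The sign-anchored regularisation and the transfer -/

/-- **The sign-anchored regularisation**: same data, `m_crit(k)` raised to `max (m_crit(k)) (signThr_k)`. -/
def signReg (reg : QCDRegularisation Nf) : QCDRegularisation Nf :=
  { reg with mcrit := fun k => max (reg.mcrit k) (signThr Nf (reg.β k) (reg.L k)) }

@[simp] theorem signReg_mcrit (reg : QCDRegularisation Nf) (k : ℕ) :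
    (signReg reg).mcrit k = max (reg.mcrit k) (signThr Nf (reg.β k) (reg.L k)) := rfl
@[simp] theorem signReg_a (reg : QCDRegularisation Nf) : (signReg reg).a = reg.a := rfl
@[simp] theorem signReg_β (reg : QCDRegularisation Nf) : (signReg reg).β = reg.β := rfl
@[simp] theorem signReg_L (reg : QCDRegularisation Nf) : (signReg reg).L = reg.L := rfl
@[simp] theorem signReg_Zm (reg : QCDRegularisation Nf) : (signReg reg).Zm = reg.Zm := rfl

/-- The increments `a_k m_f / Z_m(k)` are positive for positive tuples. -/
theorem incr_pos (reg : QCDRegularisation Nf) {m : Fin Nf → ℝ} (hm : ∀ f, 0 < m f) (k : ℕ) (f : Fin Nf) :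
    0 < reg.a k * m f / reg.Zm k :=
  div_pos (mul_pos (reg.a_pos k) (hm f)) (reg.Zm_pos k)

/-- **Clause (iv) for free** along the sign-anchored regularisation, at EVERY `k`. -/
theorem signReg_sign (reg : QCDRegularisation Nf) (m : Fin Nf → ℝ) (hm : ∀ f, 0 < m f) :
    Sign (signReg reg) m := by
  refine Eventually.of_forall fun k => ?_
  show (1 / 2 : ℝ) ≤ signRatio Nf (reg.β k) (reg.L k) (bare (signReg reg) m k)
  refine half_le_signRatio_of_signThr_lt (reg.β k) (reg.L k) _ fun f => ?_
  show signThr Nf (reg.β k) (reg.L k) <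
      max (reg.mcrit k) (signThr Nf (reg.β k) (reg.L k)) + reg.a k * m f / reg.Zm k
  have := incr_pos reg hm k f
  have := le_max_right (reg.mcrit k) (signThr Nf (reg.β k) (reg.L k))
  linarith

/-- **Clause (i) for free** along the sign-anchored regularisation, at EVERY `k`. -/
theorem signReg_clauseI (reg : QCDRegularisation Nf) (m : Fin Nf → ℝ) (hm : ∀ f, 0 < m f) :
    ClauseI (signReg reg) m := by
  intro f
  refine Eventually.of_forall fun k => ?_
  show -1 < max (reg.mcrit k) (signThr Nf (reg.β k) (reg.L k)) + reg.a k * m f / reg.Zm k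
  have := incr_pos reg hm k f
  have := neg_one_le_signThr (Nf := Nf) (reg.β k) (reg.L k)
  have := le_max_right (reg.mcrit k) (signThr Nf (reg.β k) (reg.L k))
  linarith

/-- Mass scaling is untouched by the anchoring (same `a`, `Z_m`). -/
theorem signReg_hasMassScaling {reg : QCDRegularisation Nf} (h : reg.HasMassScaling) :
    (signReg reg).HasMassScaling := h

/-- Asymptotic scaling is untouched by the anchoring (same `a`, `β`). -/
theorem signReg_hasAsymptoticScaling {reg : QCDRegularisation Nf}
    (h : (reg.scheme 0 0 0).HasAsymptoticScaling) : ((signReg reg).scheme 0 0 0).HasAsymptoticScaling := h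

/-- **THE TRANSFER (`stub_transfer`-shape).**  `ChiralMobilityGap` follows from: for `N_f ∈ {2,3}` some
data `reg` with mass and asymptotic scaling such that the SIGN-ANCHORED regularisation `signReg reg` is
chiral at zero and carries (ii) UPPER and (iii) LOWER for every positive tuple.  Clauses (i) and (iv)
have disappeared. -/
theorem ChiralMobilityGap_of_signReg
    (h : ∀ Nf : ℕ, Nf = 2 ∨ Nf = 3 → ∃ reg : QCDRegularisation Nf,
      reg.HasMassScaling ∧ (reg.scheme 0 0 0).HasAsymptoticScaling ∧
        (signReg reg).IsChiralAtZero ∧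
          ∀ m : Fin Nf → ℝ, (∀ f, 0 < m f) → Upper (signReg reg) m ∧ Lower (signReg reg) m) :
    Summit.QuantumFields.QCD.Theses.WilsonMobilityGap.ChiralMobilityGap := by
  rw [chiralMobilityGap_iff]
  intro Nf hNf
  obtain ⟨reg, hMS, hAS, hχ, hcl⟩ := h Nf hNf
  exact ⟨signReg reg, signReg_hasMassScaling hMS, hχ, signReg_hasAsymptoticScaling hAS,
    fun m hm => ⟨signReg_clauseI reg m hm, (hcl m hm).1, (hcl m hm).2, signReg_sign reg m hm⟩⟩

/-! ### §4 The pin (v) is a vanishing LOWER rate — the analytic core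

`IsChiralAtZero` negates `HasLatticeMassGap ε`: some channel must, for EVERY amplitude `K`, beat
`K e^{-ε a_k n}` frequently in `k` at SOME admissible volume and separation.  A clause-(iii)-shaped
lower bound with rate `C₁ < ε`, needed only up to the scheme's OWN side `n ≤ L_k` (where (iv) keeps the
signed and phase-quenched functionals comparable), does exactly that at `n = L_k`, because
`a_k L_k → ∞`.  (The channel-level dictionary — degenerate doublet: signed charged-pion correlator =
phase-quenched `E_{|w|}‖G‖²_F ≥ (E_{|w|}(Σ|G|)^s)^{2/s}/144` by Lyapunov; `N_f = 3`: plus sign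
decorrelation at side `2L_k+1` — is the card's `PinOfVanishingRate`, not typed here.) -/

/-- **No amplitude rescues a faster rate.**  If `C k n ≥ c₀ exp(-(C₁ a_k n + p log(n+1)))` for
`n ≤ L_k` (all large `k`), `a_k L_k → ∞` and `C₁ + θ < ε`, where `θ` absorbs the polynomial factor AT
THE SCHEME'S SIDE (`p log(L_k+1) ≤ θ a_k L_k` eventually — a condition on the witness's OWN volume
sequence, met by any `L_k = ⌈ℓ_k/a_k⌉` with `ℓ_k ≫ p·log(1/a_k)`, i.e. physical side `≫ β_k`; vacuous
for `p ≤ 0`), then for every amplitude `K` the gap-shaped bound `C k n ≤ K exp(-ε a_k n)` FAILS at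
`n = L_k`, eventually (hence frequently) in `k`.  This is the analytic core of
"pin (v) ⟸ clause (iii) with `inf_m C₁(m)/… = 0`". -/
theorem frequently_exceeds_of_lower {a : ℕ → ℝ} {L : ℕ → ℕ}
    (hL : Tendsto (fun k => a k * (L k : ℝ)) atTop atTop)
    {C : ℕ → ℕ → ℝ} {c₀ C₁ p ε θ : ℝ} (hc₀ : 0 < c₀) (hθ : C₁ + θ < ε)
    (hpoly : ∀ᶠ k in atTop, p * Real.log ((L k : ℝ) + 1) ≤ θ * (a k * (L k : ℝ)))
    (hlow : ∀ᶠ k in atTop, ∀ n : ℕ, n ≤ L k →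
      c₀ * Real.exp (-(C₁ * (a k * n) + p * Real.log (n + 1))) ≤ C k n) (K : ℝ) :
    ∃ᶠ k in atTop, ∃ n : ℕ, n ≤ L k ∧ K * Real.exp (-(ε * (a k * n))) < C k n := by
  refine Eventually.frequently ?_
  have hδ : 0 < ε - C₁ - θ := by linarith
  -- eventually `(ε - C₁ - θ) a_k L_k > log (K / c₀)` (any fixed real)
  have hbig : ∀ᶠ k in atTop, Real.log (max K 1 / c₀) < (ε - C₁ - θ) * (a k * (L k : ℝ)) :=
    (hL.const_mul_atTop hδ).eventually_gt_atTop _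
  filter_upwards [hlow, hpoly, hbig] with k hk hp hb
  refine ⟨L k, le_rfl, ?_⟩
  have h1 := hk (L k) le_rfl
  refine lt_of_lt_of_le ?_ h1
  -- compare `K e^{-ε x}` with `c₀ e^{-(C₁ x + p log(L+1))}`, `x = a_k L_k`
  set x : ℝ := a k * (L k : ℝ) with hx
  have hKle : K ≤ max K 1 := le_max_left _ _
  have hM : 0 < max K 1 := lt_of_lt_of_le one_pos (le_max_right _ _)
  calc K * Real.exp (-(ε * x))
      ≤ max K 1 * Real.exp (-(ε * x)) :=
        mul_le_mul_of_nonneg_right hKle (Real.exp_pos _).le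
    _ < c₀ * Real.exp (-(C₁ * x + p * Real.log ((L k : ℝ) + 1))) := by
        -- take logs: log M - ε x < log c₀ - C₁ x - p log(L+1)
        rw [← Real.exp_log hM, ← Real.exp_log hc₀, ← Real.exp_add, ← Real.exp_add, Real.exp_lt_exp]
        have : Real.log (max K 1 / c₀) = Real.log (max K 1) - Real.log c₀ :=
          Real.log_div hM.ne' hc₀.ne'
        nlinarith [hb, hp, this]

end Summit.QuantumFields.QCD.Cruxes.ChiralMobilityGap.SignThreshold

end
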